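import Summits.Ventures.HodgeRepro2.T5Sl2LowestWeightUnique
import Summits.Ventures.HodgeRepro2.T5Sl2LowestWeightModelIrreducible
import Summits.Ventures.HodgeRepro2.T5Sl2Casimir
import Summits.Ventures.HodgeRepro2.T5Sl2LowestWeightUnitary

/-!
# Summary: the irreducible lowest-weight-`3` module of `sl₂` on the tree

One entry point restating, for lowest weight `3` (the `K`-type `3` of `π₃⁺` in (P2′)), the
headline results of `T5Sl2LowestWeight`, `T5Sl2LowestWeightUnique`, `T5Sl2Standard`,
`T5Sl2LowestWeightModel(Irreducible)`, `T5Sl2Casimir` and `T5Sl2LowestWeightUnitary`, each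
proved by reference.  `K` is a field of characteristic zero, `sl₂(K) = sl (Fin 2) K` with its
standard triple `(h₀, e₀, f₀)`, and `M` an `sl₂(K)`-module.

1. `weights_of_three` / `multiplicity_one_of_three`: an irreducible `M` with a lowest-weight
   vector of weight `3` has `h₀`-eigenvalues exactly `3, 5, 7, …`, each of multiplicity one.
2. `model_three_lowest` / `model_three_irreducible`: the model `Model K 3` on `ℕ →₀ K` is such a
   module (existence).
3. `equiv_model_of_three`: every such `M` is isomorphic to `Model K 3` (uniqueness).
4. `casimir_of_three`: the Casimir element `h₀² + 2 e₀ f₀ + 2 f₀ e₀` acts on such `M` as the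
   scalar `3`.
5. `form_three_pos` / `form_three_lie`: on `Model ℂ 3` the hermitian form of
   `T5Sl2LowestWeightUnitary` is positive definite and `su(1,1)`-invariant (algebraic
   unitarity).

What the tree does NOT say (printed inputs [C] of (P2′), route/T5-SUPPORT-p1.md §S4.16): that
the `K`-finite vectors of `π₃⁺` form this module, that `h₀ = −I • W` gives the `SO(2)`-character
at the group level, and the Hilbert-space completion.

Blind lane: Mathlib + own prefix; no sorry; axioms ⊆ {propext, Classical.choice, Quot.sound}.
-/

namespace Summit.Ventures.HodgeRepro2.T5Sl2LowestWeightSummary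

open LieAlgebra.SpecialLinear LieModule Module
open Summit.Ventures.HodgeRepro2.T5Sl2LowestWeight Summit.Ventures.HodgeRepro2.T5Sl2Standard
  Summit.Ventures.HodgeRepro2.T5Sl2LowestWeightModel
  Summit.Ventures.HodgeRepro2.T5Sl2LowestWeightModelIrreducible
  Summit.Ventures.HodgeRepro2.T5Sl2LowestWeightUnique Summit.Ventures.HodgeRepro2.T5Sl2Casimir
  Summit.Ventures.HodgeRepro2.T5Sl2LowestWeightUnitary

variable {K : Type*} [Field K] [CharZero K]
variable {M : Type*} [AddCommGroup M] [Module K M] [LieRingModule (sl (Fin 2) K) M]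
  [LieModule K (sl (Fin 2) K) M]

/-- **1a. The weights**: the `h₀`-eigenvalues of an irreducible `sl₂(K)`-module with a
lowest-weight vector of weight `3` are exactly `3, 5, 7, …`. -/
theorem weights_of_three [LieModule.IsIrreducible K (sl (Fin 2) K) M] {m : M}
    (P : HasLowestWeightVector (isSl2Triple K) m (3 : K)) (c : K) :
    (toEnd K (sl (Fin 2) K) M (h₀ K)).HasEigenvalue c ↔ ∃ n : ℕ, c = 3 + 2 * n :=
  hasEigenvalue_h₀_iff_of_three P c

/-- **1b. Multiplicity one**: each weight `3 + 2n` occurs exactly once. -/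
theorem multiplicity_one_of_three [LieModule.IsIrreducible K (sl (Fin 2) K) M] {m : M}
    (P : HasLowestWeightVector (isSl2Triple K) m (3 : K)) (n : ℕ) :
    Module.finrank K ((toEnd K (sl (Fin 2) K) M (h₀ K)).eigenspace (3 + 2 * n)) = 1 :=
  finrank_eigenspace_h₀_eq_one_of_three P n

omit [CharZero K] in
/-- **2a. Existence**: `v₀` is a lowest-weight vector of weight `3` of the model `Model K 3`. -/
theorem model_three_lowest : HasLowestWeightVector (isSl2Triple K) (v K (3 : K) 0) (3 : K) :=
  hasLowestWeightVector K 3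

/-- **2b. Existence**: the model `Model K 3` is irreducible. -/
theorem model_three_irreducible : LieModule.IsIrreducible K (sl (Fin 2) K) (Model K (3 : K)) :=
  isIrreducible_three K

/-- **3. Uniqueness**: every irreducible `sl₂(K)`-module with a lowest-weight vector of weight
`3` is isomorphic to the model `Model K 3`. -/
theorem equiv_model_of_three [LieModule.IsIrreducible K (sl (Fin 2) K) M] {m : M}
    (P : HasLowestWeightVector (isSl2Triple K) m (3 : K)) :
    Nonempty (M ≃ₗ⁅K, sl (Fin 2) K⁆ Model K (3 : K)) :=
  haveI := isIrreducible_three K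
  nonempty_lieModuleEquiv_of_three P (hasLowestWeightVector K 3) (toLieSubalgebra_eq_top K)

/-- **4. The Casimir scalar**: `h₀² + 2 e₀ f₀ + 2 f₀ e₀` acts as `3`. -/
theorem casimir_of_three [LieModule.IsIrreducible K (sl (Fin 2) K) M] {m : M}
    (P : HasLowestWeightVector (isSl2Triple K) m (3 : K)) :
    casimir (K := K) (M := M) (isSl2Triple K) = (3 : K) • (1 : Module.End K M) :=
  casimir_eq_smul_id_of_three P (toLieSubalgebra_eq_top K)

/-- **5a. Positivity** of the hermitian form on `Model ℂ 3`. -/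
theorem form_three_pos {w : ℕ →₀ ℂ} (hw : w ≠ 0) :
    0 < (form 3 w w).re ∧ (form 3 w w).im = 0 :=
  form_self_pos 3 (by norm_num) hw

/-- **5b. Invariance** of the hermitian form on `Model ℂ 3` under `su(1,1)`. -/
theorem form_three_lie (x : sl (Fin 2) ℂ) (hx : IsSU11 x.val) (w w' : Model ℂ ((3 : ℝ) : ℂ)) :
    form 3 (toFinsupp ℂ 3 ⁅x, w⁆) (toFinsupp ℂ 3 w') =
      -form 3 (toFinsupp ℂ 3 w) (toFinsupp ℂ 3 ⁅x, w'⁆) :=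
  form_lie 3 x hx w w'

end Summit.Ventures.HodgeRepro2.T5Sl2LowestWeightSummary
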